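import Summits.FinalStateConjecture.FinalStateConjecture.Theses.SwallowTheDatum
import Summits.FinalStateConjecture.FinalStateConjecture.Theorems.KerrShieldedDataExist.Negative.BentSliceConormal
import Literature.Geometry.Lorentzian.ModelData
import Literature.Geometry.Lorentzian.LorentzianMetricProofs

/-!
# Line `killing-flow-transport` — skeleton for the crux `SwallowTheDatum.KerrShieldedSettles`
# (item stmt-FinalStateConjecture-10054, rank 4)

Planner seat `cruxplan-stmt-FinalStateConjecture-10054-killing-flow-transpo`, round 2, 2026-08-16.
Idea card `Cruxes/KerrShieldedSettles/Ideas/killing-flow-transport.md` (ideator 4; passed by all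
three triagers, `TRIAGE-r2-{1,2,3}.md`, with the note "glue card: pick it bundled with the M2
engine, or accept a second named-fact hypothesis"); line card `Lines/killing-flow-transport.md`.
`lean check` rc 0, sorries ONLY in the seven `stub_*`; `KerrShieldedSettles_of` concludes the crux
BY NAME (real proof) from the seven stub signatures and the route item `SubdataDevelopmentsEmbed`
(stmt-FinalStateConjecture-10053 — the crux's DECLARED dependency `[deps: SubdataDevelopmentsEmbed]`,
a tagged `route_item`, hence an admissible hypothesis of the skeleton theorem).

## The crux (FIXED; `Theses/SwallowTheDatum.lean` l.363)

`∀ [Kerr.Facts] X …, ∀ D ∈ admissibleVacuumData X, (∃ M a r₁ (hM : 0 ≤ M) T φ ψ ν, |a| < M ∧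
r₋ < r₁ < r₊ ∧ T = ⟨hard-coded bent height⟩ ∧ IsCompact (range φ)ᶜ ∧ IsOpenEmbedding φ ∧ C^∞ φ ∧
ψ = graph of T∘r ∧ ψ spacelike ∧ ν future unit normal ∧ φ^*h = ψ^*g_{M,a} ∧ φ^*k = K_ν(ψ)) →
∀ 𝒟 : VacuumCauchyDevelopment D, 𝒟.IsMaximal → HasCompleteNullInfinity 𝒟 ∧ ∃ O dec,
(∀ i, IsSubextremal (dec.mass i) (dec.spin i)) ∧ O = exteriorOf 𝒟 dec.charted ∧ HasExhaustiveCharts dec`.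

## The line (one paragraph)

Unpack the shield; `T = bentHeight M a` (`rfl`) and `ψ = graph M a r₁` (`psi_eq_graph`, landed
Negative lane of the sibling crux).  (1) Build the EXPLICIT vacuum Cauchy development of the
pulled-back data `D.comap φ` on an open window `U ⊇ W⁺ := {t* ≥ T(r)}` of the ingoing Kerr–Schild
chart (tapered collar `{t* − T(r) > −¼(r − r₁)}`, triage merge M1) — this needs `Ric(g_{M,a}) = 0`
(`stub_kerrVacuum`, the named fact `Kerr.isRicciFlat`) — and push it into the given MGHD `𝒟`
with the route item `SubdataDevelopmentsEmbed`: a SHIELD WINDOW `(U, χ)` (`stub_shieldWindow`,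
interface `IsShieldWindow`).  (2) EXTERIOR IGNORANCE (Disproof §C1 last-exit argument): for every
cofinal charted set `A` in the exterior part `ext := {r > r₊, t* ≥ T(r)}` of the window,
`exteriorOf 𝒟 (χ '' A) = χ '' ext` — nothing of `𝒟` outside the explicit Kerr region is ever read
(`stub_exteriorIgnorance`).  (3) CLAUSE (a) BY KILLING-FLOW TRANSPORT — the card's lever: the
stationary flow `Φ_s(t*, y) = (t* + s, y)` of the chart is a time-orientation-preserving isometry,
so a normalised ray from the bent-leaf point `(T(r_p), p)` is `Φ_{T(r_p)}` of a ray from the FLAT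
leaf point `(0, p)` re-normalised by a bounded factor `c ∈ [0.88, 1.13]` (triage N6/T3/checkB at
`r_p = 16M`), and `Φ_{T(r_p)} J⁺(ι_KS B₀) ⊆ J⁺(graph '' B₀')` because `∂_{t*}` is future timelike on
`{r > 2M}` and `T` is monotone: the vendored sanity fact `kerr_hasCompleteFutureNullInfinity M a (8M)`
(ModelData; `stub_kerrScriFar` = its `_holds`, the M2 engine's target) yields sojourn-completeness
of the chart seen from the bent leaf (`stub_flowTransport`), which `χ` pushes into `𝒟`
(`stub_scriPush`: ray transport through an isometric open embedding + inner-edge capping by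
completeness / `IsSoleEnd`, Disproof §H1/§H3).  (4) CLAUSES (b)/(c): the `N = 1` decomposition of
`O := χ '' ext` with RECEDING hole bend (Disproof §C3: on its growing near zone the hole chart IS
`χ ∘ Φ_{c₀}`, an isometry, so `truncDeviationCk ≡ 0` eventually — the flow again), flat chart bent
by `T` on `{r > √x⁰}` with `C²` deviation `O(M/√τ)`, and the `∀ τ₁` covering of
`HasExhaustiveCharts` by `∂_{t*}`-lines / `ω(r,θ)`-helices (Disproof §C4/§F/§I) — all inside `ext`,
pushed through `χ`, with charted set `χ '' A`, `A` cofinal in `ext` (`stub_exhaustiveCharts`).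
`KerrShieldedSettles_of` composes (1)–(4) by pure logic.

LOAD-BEARING (the card's lever): `stub_flowTransport`.  HARDEST: `stub_exhaustiveCharts` (XL).

## Disproof used (`Cruxes/KerrShieldedSettles/Disproof.lean`, cdisprove rev 5, rc 0, sorry-free)

* NO `_false_without_<H>` theorem exists (§A/§D: `¬S` needs an `IsMaximal` witness); the prose
  load-bearing list is honoured stub by stub: `r₁ < r₊` is consumed in `stub_exteriorIgnorance`
  (one-way membrane: `χ(W⁺) ∩ I⁻(χ A) ⊆ χ{r > r₊}`, §J1 `infall_of_causal_inside` /
  `not_outward_of_causal_horizon`) and in `stub_shieldWindow` (hole clock of the collar, §J2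
  `conormalSq_hole_collar_lt`); ADMISSIBILITY (§H1, `KerrShieldedSettlesWithoutAdmissible` false on
  paper: completeness / sole end load-bearing) is consumed exactly once, by `stub_scriPush`
  (compactness of `B₁ = X ∖ φ{‖y‖ > R₁}`); MAXIMALITY of `𝒟` (§D bullet 5) is consumed by
  `stub_shieldWindow` (through `SubdataDevelopmentsEmbed`); `SubdataDevelopmentsEmbed` enters only
  through `∃ χ` for the ONE explicit development (§D bullet 4, §H4) — by name, as a hypothesis.
* Refuted strengthening `not_exists_unbent_bound` (§B) and the LANDED negative lemma
  `Theorems/KerrShieldedSettles/Negative/StationaryBendDead.lean`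
  (`not_tendsto_stationaryBend_dev`: a time-INDEPENDENT hole bend violates
  `tendsto_truncDeviationCk ∀ R`; NOT imported — the farm reported that module unbuilt on
  2026-08-16 — and nothing to check it against anyway): `stub_exhaustiveCharts`
  asks for the decomposition abstractly (no chart shape is pinned, so no stub is an instance the
  lemma refutes) and its docstring prescribes the x⁰-RECEDING bend of §C3 / one-gauge-sliding-seam,
  to which `Φ` is applied only on the growing near zone — never the dead stationary hole clock
  (TRIAGE r1-2 T2 / r1-3 L1).
* §I corrections respected: no sharp radial ledger anywhere (all optics is inside the vendored
  fact, §J5 (vii)); reflexive `J⁻` and the `θ`-squeeze are part of `stub_exhaustiveCharts`.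
* §J3: `cardA_first_lemma` (= `stub_flowTransport` here, with the landed `graph`) attacked on paper
  by the disprover and NOT false ("C2 on the chart region `{r > r₁}`: more curves than `W⁺`, so `J⁺`
  is larger and sojourns only grow").
* `ledger negatives --problem FinalStateConjecture` = 0 refuted statements (2026-08-16).
-/

set_option linter.dupNamespace false

noncomputable section

namespace Summit.FinalStateConjecture.FinalStateConjecture.Cruxes.KerrShieldedSettles.KillingFlowTransport

open scoped Manifold ContDiff Topology
open Bundle Set Filter Function TopologicalSpace Literature.Geometry.Lorentzian
open Summit.FinalStateConjecture.FinalStateConjecture.Theorems.KerrShieldedDataExist.Negative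
  (bentHeight bentHeight_eq_literal graph coe_graph psi_eq_graph mass_pos radius_ofTimeSpace)

/-! ## Vocabulary (all over existing tree declarations)

LEAD: these six definitions are the interfaces between the stubs.  Land them FIRST as a sorry-free
Theorems file (e.g. `Theorems/KerrShieldedSettles/KillingFlowTransportVocabulary.lean`, same bodies)
so that stub workers can import them and restate the registered `Sig.stub_*` bodies verbatim. -/

section Vocabulary

variable [Kerr.Facts]

/-- **The shield, verbatim.** The hypothesis of the crux on `(X, D, M, a, r₁, φ, ψ, ν)` with the
immersion `ψ` already identified with the graph `graph M a r₁ : y ↦ (T_{M,a}(r(0,y)), y)` of the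
hard-coded height `T = bentHeight M a` (`psi_eq_graph`: the crux's graph clause pins `ψ`;
`bentHeight_eq_literal` is `rfl`), i.e. the remaining ten conjuncts of the crux's
`∃ (M a r₁) (hM) (T) (φ) (ψ) (ν), …`, in the crux's order and spelling. -/
def IsShield (X : Type) [TopologicalSpace X] [ChartedSpace E3 X] [IsManifold (𝓡 3) ∞ X]
    (D : InitialDataSet (𝓡 3) X) (M a r₁ : ℝ) (hM : 0 ≤ M) (φ : Kerr.slice a r₁ → X)
    (ν : NormalField 𝓘(ℝ, E4) (graph M a r₁)) : Prop :=
  |a| < M ∧ Kerr.rMinus M a < r₁ ∧ r₁ < Kerr.rPlus M a ∧ IsCompact (Set.range φ)ᶜ ∧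
    Topology.IsOpenEmbedding φ ∧ ContMDiff 𝓘(ℝ, E3) (𝓡 3) ∞ φ ∧
    (Kerr.smoothMetric M a r₁).IsSpacelikeImmersion 𝓘(ℝ, E3) (graph M a r₁) ∧
    (Kerr.smoothMetric M a r₁).IsFutureUnitNormal 𝓘(ℝ, E3)
      ((Kerr.timeOrientation M a r₁ hM).ofLE le_top) (graph M a r₁) ν ∧
    (∀ y : Kerr.slice a r₁,
      pullbackBilin (I := 𝓡 3) (I' := 𝓘(ℝ, E3)) φ D.h.inner y =
        pullbackBilin (I := 𝓘(ℝ, E4)) (I' := 𝓘(ℝ, E3)) (graph M a r₁) (Kerr.smoothMetric M a r₁).val y) ∧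
    (∀ [(Kerr.smoothMetric M a r₁).HasLeviCivita] (y : Kerr.slice a r₁),
      (pullbackBilin (I := 𝓡 3) (I' := 𝓘(ℝ, E3)) φ D.k y).toLinearMap₁₂ =
        (Kerr.smoothMetric M a r₁).secondFundamentalForm 𝓘(ℝ, E3) (graph M a r₁) ν y)

/-- **The window spacetime** `(U, g_{M,a}|_U, −g♯dt*|_U)`: the open sub-spacetime of the
Kerr–Schild chart spacetime `Kerr.spacetime M a r₁ hM` on a connected open `U ⊆ Kerr.region a r₁`
(`Spacetime.restrict` with the discharged restriction facts `contMDiff_restrict_holds`; carrier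
`↥U` definitionally). -/
abbrev windowSpacetime (M a r₁ : ℝ) (hM : 0 ≤ M) (U : Opens (Kerr.region a r₁))
    (hU : IsConnected (U : Set (Kerr.region a r₁))) : Spacetime 4 :=
  (Kerr.spacetime M a r₁ hM).restrict PseudoRiemannianMetric.contMDiff_restrict_holds
    (Kerr.spacetime M a r₁ hM).timeOrientation.contMDiff_restrict_holds U hU

/-- **The chart future of the bent leaf**, `W⁺ = {x ∈ Kerr.region a r₁ | T(r(x)) ≤ x⁰}`
(the leaf `t* = T(r)` itself included; Disproof §C: `W⁺ ∪ Σᵉ = {u ≥ 0}`, `u = t* − T(r)`). -/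
def leafFuture (M a r₁ : ℝ) : Set (Kerr.region a r₁) :=
  {x | bentHeight M a (Kerr.radius a (x : E4)) ≤ (x : E4) 0}

/-- **The exterior part of `W⁺` in the window `U`**, `ext = {r > r₊} ∩ {T(r) ≤ x⁰}` as a set
of points of `U` (for a shield window `W⁺ ⊆ U`, so nothing is lost).  Its `χ`-image is the region
`O` of the crux (Disproof §C1: "`O = {r > r₊, t* ≥ T(r)}` exactly"). -/
def extSet (M a r₁ : ℝ) (U : Opens (Kerr.region a r₁)) : Set U :=
  {x | Kerr.rPlus M a < Kerr.radius a ((x : Kerr.region a r₁) : E4) ∧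
    bentHeight M a (Kerr.radius a ((x : Kerr.region a r₁) : E4)) ≤ ((x : Kerr.region a r₁) : E4) 0}

/-- `A` is **cofinal in `S`** inside the window spacetime: every point of `S` is joined to a
point of `A` by a future-directed timelike curve OF THE WINDOW SPACETIME on `[0, 1]` that stays in
`S` (realised in `stub_exhaustiveCharts` by fixed-`x⃗` `∂_{t*}`-lines outside the ergoregion and
fixed-`(r, θ)` helices `∂_t + ω∂_φ` inside it, Disproof §C4/§F/§I, tree
`Kerr.exists_isTimelike_stationaryField_add_smul_axialField`, `Kerr.isTimelike_drsrField`).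
Consumed by `stub_exteriorIgnorance` (such curves lie in `U`, so `χ` pushes them into `𝒟`). -/
def CofinalIn (M a r₁ : ℝ) (hM : 0 ≤ M) (U : Opens (Kerr.region a r₁))
    (hU : IsConnected (U : Set (Kerr.region a r₁)))
    (A S : Set (windowSpacetime M a r₁ hM U hU).carrier) : Prop :=
  ∀ x ∈ S, ∃ γ : ℝ → (windowSpacetime M a r₁ hM U hU).carrier,
    γ 0 = x ∧ γ 1 ∈ A ∧ (∀ t ∈ Set.Icc (0 : ℝ) 1, γ t ∈ S) ∧
    (windowSpacetime M a r₁ hM U hU).metric.IsFutureTimelikeCurveOn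
      (windowSpacetime M a r₁ hM U hU).timeOrientation γ (Set.Icc 0 1)

/-- **Shield window** — the interface object of the line (output of `stub_shieldWindow`, input
of stubs 3, 6, 7).  An open connected `U ⊆ Kerr.region a r₁` containing the chart future `W⁺`
of the bent leaf, in which the bent leaf `graph(Kerr.slice a r₁)` is a Cauchy hypersurface of the
window spacetime, together with a smooth, time-orientation-preserving, isometric open embedding
`χ` of the window spacetime into the development `𝒟` matching the data embeddings
(`χ ∘ graph = ι ∘ φ`) and the future unit normals (`dχ ν = ν_𝒟 ∘ φ`).  The four embedding
conjuncts are spelled exactly as in `DataEmbedding.EmbedsInto` / `SubdataDevelopmentsEmbed`. -/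
structure IsShieldWindow {X : Type} [TopologicalSpace X] [ChartedSpace E3 X]
    [IsManifold (𝓡 3) ∞ X] [ConnectedSpace X] {D : InitialDataSet (𝓡 3) X}
    (𝒟 : VacuumCauchyDevelopment D) (M a r₁ : ℝ) (hM : 0 ≤ M) (φ : Kerr.slice a r₁ → X)
    (ν : NormalField 𝓘(ℝ, E4) (graph M a r₁)) (U : Opens (Kerr.region a r₁))
    (hU : IsConnected (U : Set (Kerr.region a r₁)))
    (χ : (windowSpacetime M a r₁ hM U hU).carrier → 𝒟.carrier) : Prop where
  /-- `W⁺ ⊆ U`: the window contains the whole chart future of the bent leaf (leaf included). -/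
  leafFuture_subset : leafFuture M a r₁ ⊆ (U : Set (Kerr.region a r₁))
  /-- The bent leaf is a Cauchy hypersurface of the window spacetime (corrected notion: met
  exactly once by every endless timelike curve of `(U, g|_U, τ|_U)`). -/
  isCauchy : (windowSpacetime M a r₁ hM U hU).metric.IsCauchyHypersurface
    (windowSpacetime M a r₁ hM U hU).timeOrientation
    {x : U | (x : Kerr.region a r₁) ∈ Set.range (graph M a r₁)}
  /-- `χ` is smooth, -/
  contMDiff : ContMDiff (𝓡 4) (𝓡 4) ∞ χ
  /-- an open topological embedding, -/
  isOpenEmbedding : Topology.IsOpenEmbedding χ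
  /-- an isometric immersion `χ^* g_𝒟 = g_{M,a}|_U`, -/
  isIsometricImmersion : (windowSpacetime M a r₁ hM U hU).metric.IsIsometricImmersion
    𝒟.metric.toPseudoRiemannianMetric χ
  /-- and time-orientation preserving. -/
  preservesTimeOrientation :
    (windowSpacetime M a r₁ hM U hU).timeOrientation.PreservesTimeOrientation χ 𝒟.timeOrientation
  /-- `χ ∘ graph = ι ∘ φ` on the slice. -/
  embed_comm : ∀ (y : Kerr.slice a r₁) (hy : graph M a r₁ y ∈ U),
    χ (⟨graph M a r₁ y, hy⟩ : U) = 𝒟.embed (φ y)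
  /-- `dχ` carries the shield's future unit normal `ν` to the development's future unit normal
  (forced by the rest — unit normals of a spacelike hypersurface are unique — but exported so
  that `stub_scriPush` is self-contained). -/
  normal_comm : ∀ (y : Kerr.slice a r₁) (hy : graph M a r₁ y ∈ U),
    mfderiv (𝓡 4) (𝓡 4) χ (⟨graph M a r₁ y, hy⟩ : U) (ν y) = 𝒟.normal (φ y)

/-- **Sojourn-completeness of the Kerr–Schild chart seen from the BENT leaf, far region** — the
chart-level form of clause (a) (exactly the shape of `HasCompleteFutureNullInfinity`, with `B₁`
rendered as a coordinate radius `R₁`; cf. the card's `cardA_first_lemma`): there is a compact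
`B₀ ⊆ Kerr.slice a r₁` such that for every `s > 0`, beyond some `R₁` every normalised future null
ray of `(Kerr.region a r₁, g_{M,a}, −g♯dt*)` from `graph(p)`, normalised against `ν p`, is future
complete or sojourns affine time `≥ s` in `J⁺(graph '' B₀)` (causal future IN THE CHART
`Kerr.region a r₁`).  The Levi-Civita hypothesis of the ray notions is bound innermost, as in
`kerr_hasCompleteFutureNullInfinity` / `HasCompleteNullInfinity` (it is discharged by
`PseudoRiemannianMetric.hasLeviCivita`, or by `Kerr.hasLeviCivita_smoothMetric` under
`Kerr.sliceFacts_holds`). -/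
def BentLeafScriComplete (M a r₁ : ℝ) (hM : 0 ≤ M)
    (ν : NormalField 𝓘(ℝ, E4) (graph M a r₁)) : Prop :=
  ∀ [(Kerr.smoothMetric M a r₁).HasLeviCivita],
    ∃ B₀ : Set (Kerr.slice a r₁), IsCompact B₀ ∧ ∀ s : ℝ, 0 < s → ∃ R₁ : ℝ,
      ∀ p : Kerr.slice a r₁, R₁ < ‖(p : E3)‖ →
        ∀ (γ : ℝ → Kerr.region a r₁) (dom : Set ℝ),
          (Kerr.smoothMetric M a r₁).IsNormalisedNullRayFrom
              ((Kerr.timeOrientation M a r₁ hM).ofLE le_top) (graph M a r₁) ν p γ dom →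
            ¬ BddAbove dom ∨ ENNReal.ofReal s ≤ sojournTime γ dom
              ((Kerr.smoothMetric M a r₁).causalFuture
                ((Kerr.timeOrientation M a r₁ hM).ofLE le_top) (graph M a r₁ '' B₀))


/-! ### Definitional sanity checks (documentation for the stub workers; no new declarations) -/

/-- The window spacetime has carrier `↥U` definitionally (so `(⟨x, hx⟩ : U)` may be fed to `χ`). -/
example (M a r₁ : ℝ) (hM : 0 ≤ M) (U : Opens (Kerr.region a r₁))
    (hU : IsConnected (U : Set (Kerr.region a r₁))) :
    (windowSpacetime M a r₁ hM U hU).carrier = U := rfl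

/-- The bent leaf lies in its own chart future `W⁺` (equality in the defining inequality). -/
example (M a r₁ : ℝ) (y : Kerr.slice a r₁) : graph M a r₁ y ∈ leafFuture M a r₁ := by
  show bentHeight M a (Kerr.radius a (graph M a r₁ y : E4)) ≤ (graph M a r₁ y : E4) 0
  rw [coe_graph, radius_ofTimeSpace, E4.ofTimeSpace_apply_zero]

/-- Points of `extSet` lie in `W⁺` (as points of the chart). -/
example (M a r₁ : ℝ) (U : Opens (Kerr.region a r₁)) (x : U) (hx : x ∈ extSet M a r₁ U) :
    (x : Kerr.region a r₁) ∈ leafFuture M a r₁ := hx.2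

end Vocabulary

/-! ## The seven stub STATEMENTS

Each stub statement is the `Prop` `Sig.stub_<name>`; the registered obligation is
`theorem stub_<name> : Sig.stub_<name> := by sorry` below, and `KerrShieldedSettles_of` takes the
seven signatures (and the route item `SubdataDevelopmentsEmbed`) as hypotheses BY NAME (skeleton
audit: hypothesis heads = stub names / tagged obligations). -/

/-- **Stub 1 — `stub_kerrVacuum`: the Kerr–Schild metric is vacuum** (size XL as a formalisation,
a theorem since 1963).  `Ric(g_{M,a}) = 0` on the chart domain `{r > r₀}`, `r₀ > 0`, for all real
`M, a` (the named fact `Kerr.isRicciFlat`, KerrSchild.lean l.763: `∀ [HasLeviCivita], ∀ x, Ric_x = 0`;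
NO `_holds` in the tree — the largest shared formalisation debt of every line on this crux,
TRIAGE r2-1 S1 / r2-2 / r2-3, Disproof §H4).  Consumed by `stub_shieldWindow` (the window must be a
`VacuumCauchyDevelopment` before `SubdataDevelopmentsEmbed` applies).
Why true: Kerr, PRL 11 (1963); Kerr–Schild 1965 §3 (the double-copy form `g = η + 2Hℓ⊗ℓ` with
`ℓ` geodesic shear-free null and `H = Mr³/(r⁴ + a²z²)` solves `Ric = 0` identically in `M`);
O'Neill 1995, Ch. 2.  Route for the prover (`provefact`, take-the-blocker → Literature
`Kerr.isRicciFlat_holds`): Kerr–Schild curvature formula `R_{μν} = ½(∂_μ∂_α(φ ℓ^α ℓ_ν) + …)` for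
`g = η + φℓ⊗ℓ` with `ℓ` null geodesic for `η` (linear in `φ`!), or brute symbolic verification in
the chart with `r` treated as a variable constrained by its quartic (`Kerr.radius_quartic`) — the
tree has the component/derivative API (`KerrSchildCoord`, `KerrSchildDerivativeDecay`,
`KerrNullShearFree`, `CoordCurvature`/`ChartCurvature`); `a = 0` first (`Minkowski.isRicciFlat_holds`
is the `M = 0` template).  Why it might fail: only as a typing accident (sign/normalisation of
`PseudoRiemannianMetric.ricci`) — then EVERY line dies at once and the auditors are told.
Leans on: `Kerr.isRicciFlat`, `Kerr.metric`, `PseudoRiemannianMetric.ricci`, `Kerr.Facts`. -/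
def Sig.stub_kerrVacuum : Prop :=
  ∀ [Kerr.Facts] (M a r₀ : ℝ), 0 < r₀ → Kerr.isRicciFlat M a r₀

/-- **Stub 2 — `stub_shieldWindow`: the explicit Kerr development of the shield and its embedding
into every MGHD** (size L; triage merge M1 `tapered-temporal-collar ≈ three-clocks-pinched-development
≈ pinched-sandwich-cauchy`, all passed ×3).  Given the route item `SubdataDevelopmentsEmbed`
(10053) by name, the shield, `Ric(g_{M,a}) = 0` on `{r > r₁}` (stub 1) and a MAXIMAL vacuum Cauchy
development `𝒟` of `D`: there is a shield window `(U, χ)` (`IsShieldWindow`).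
Intended proof.  `U := W_c = {x | x⁰ − T(r) > −c(r − r₁)}`, `c = ¼` (open; connected as a union of
`t*`-intervals over the connected slice; `⊇ W⁺`).  CAUCHY-NESS of `Σᵉ = graph(slice)` in `W_c` by
order theory for three clocks strictly increasing along future timelike curves of the chart:
`u = t* − T(r)` (conormal `dt* − T′dr` timelike: landed `conormalForm_deriv_bentHeight_neg`,
`BentSliceConormal.lean`), `w = u + c(r − r₁)` (slope `T′ − c` between `−c` and `T′`, convexity of
`conormalSq` in the slope on `{Δ > 0}`, and `conormalSq … (−c) < −1` in the hole for `c ≤ ½`,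
Disproof §J2 `conormalSq_hole_collar_lt` — uniform in `(M, a, r₁)`, no numerics), and `r` inside
the hole (`dr < 0` on future causal vectors for `r₋ < r < r₊`, Disproof §J1/§H1′, TRIAGE N2/T2:
0 exceptions) with the Grönwall covector `Kerr.horizonCovector_causal` + `delta_le_mul_sub_rPlus`
(KerrHorizonCausality) for "no exit through `r₊`" (sharpening S3); escape trichotomy of endless
curves (`t* → ∓∞` by the KS speed limit `|ẋ⃗| ≤ ṫ*`, Disproof `spatial_sq_le_of_causal`; edge
`r → r₁⁺` excluded by `w ↑, w > 0` vs `c(r − r₁) → 0`; `T ≤ 2M log(r/M)`, landed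
`bentHeight_le_two_mul_log`), template `Minkowski.isCauchyHypersurface_range_sliceEmbed`.  DATA
EMBEDDING over `(W_c, g|, τ|)` (= `windowSpacetime`, the `DataEmbedding.restrict` pattern of
`CauchyDevelopmentRestrict.lean`): `embed := graph` (smooth embedding: graph of the `C^∞` function
`T ∘ r`, `contDiff` of `bentHeight` for `M > 0` + analyticity of `Kerr.radius` on `{r > 0}`),
`normal := ν`, `isFutureUnitNormal` = shield conjunct, `induced_h`/`induced_k` = the shield
identities `φ^*h = graph^*g`, `φ^*k = K_ν(graph)` rewritten through `InitialDataSet.comap_h_inner` /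
`kBilin_comap` and the restriction naturality lemmas (`PseudoRiemannianMetric.restrict_eq_comap`,
`secondFundamentalForm_comap`), `isRicciFlat` from stub 1 by `ricci_comap_apply`
(`isRicciFlat_restrict` pattern); the hypotheses of `D.comap φ hΦ hΦ'`: `hΦ` from the shield's
`C^∞ φ` (`∞ + 1 = ∞` in `ℕ∞ω`), `hΦ'` (injective differentials) from `φ^*h = graph^*g` positive
definite; `ConnectedSpace (Kerr.slice a r₁)` from `Kerr.sliceFacts_holds` (KerrSliceFacts.lean —
NB the farm reported this module "unbuilt" on 2026-08-16; `Kerr.isConnected_slice` is its first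
field).  Then `SubdataDevelopmentsEmbed X D 𝒟 hmax (slice) φ hΦ hΦ' hφ 𝒟_W` gives `χ` with the four
embedding conjuncts and `χ ∘ graph = ι ∘ φ`; `normal_comm` by uniqueness of the future unit normal
of the spacelike hypersurface `ι(X)` at `ι(φ y)` (`dχ` is a linear isometry mapping
`T(graph(slice))` onto `T(ι X)` since `dφ` is onto, and future cone to future cone,
`PreservesTimeOrientation.isFutureDirected_mfderiv`; cf. `mfderiv_normal_rel` in
`Theorems/SwallowTheDatumSubdataDevelopmentsEmbedRigidity.lean`).
Why it might fail: only through a typing defect of `IsCauchyHypersurface`/`HasFutureEndpoint` at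
the inner edge (checked by all three triagers: curves on `[a,b]` and convergent curves HAVE
endpoints, so they are not endless; `s.Nonempty` excludes junk) or of `CauchyDevelopment`
(Disproof §J5 (i): no reversed-twin / vacuity trap).  Admissibility of `D` is NOT needed here
(the coreless slice of §H1 also has a window; completeness is consumed in stub 6).
Leans on: `SubdataDevelopmentsEmbed` (route item, by name), `Spacetime.restrict`,
`PseudoRiemannianMetric.contMDiff_restrict_holds`, `TimeOrientation.contMDiff_restrict_holds`,
`InitialDataSet.comap`, `VacuumCauchyDevelopment`, `graph`/`bentHeight`/`conormalForm_*`/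
`bentSlope_*` (landed Negative lane of 10055), `Kerr.horizonCovector_causal`,
`Kerr.delta_le_mul_sub_rPlus`, `OpensCausality`, Disproof §J1/§J2 lemmas (re-prove or land). -/
def Sig.stub_shieldWindow : Prop :=
  ∀ [Kerr.Facts] (X : Type) [TopologicalSpace X] [ChartedSpace E3 X]
    [IsManifold (𝓡 3) ∞ X] [T2Space X] [SecondCountableTopology X] [ConnectedSpace X]
    (D : InitialDataSet (𝓡 3) X) (M a r₁ : ℝ) (hM : 0 ≤ M) (φ : Kerr.slice a r₁ → X)
    (ν : NormalField 𝓘(ℝ, E4) (graph M a r₁)),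
    Summit.FinalStateConjecture.FinalStateConjecture.Theses.SwallowTheDatum.SubdataDevelopmentsEmbed →
    IsShield X D M a r₁ hM φ ν → Kerr.isRicciFlat M a r₁ →
    ∀ 𝒟 : VacuumCauchyDevelopment D, 𝒟.IsMaximal →
      ∃ (U : Opens (Kerr.region a r₁)) (hU : IsConnected (U : Set (Kerr.region a r₁)))
        (χ : (windowSpacetime M a r₁ hM U hU).carrier → 𝒟.carrier),
        IsShieldWindow 𝒟 M a r₁ hM φ ν U hU χ

/-- **Stub 3 — `stub_exteriorIgnorance`: the exterior region of the crux is the `χ`-image of the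
explicit Kerr exterior above the leaf** (size L; Disproof §C1, answering refuter g41-38 (b) and
TRIAGE r1-2 T5 / r1-3 L6: NO maximality of the window, NO MGHD uniqueness).  For a shield window
`(U, χ)` and every `A ⊆ ext = {r > r₊, t* ≥ T(r)}` cofinal in `ext`:
`exteriorOf 𝒟 (χ '' A) = J⁺(ι X) ∩ I⁻(χ '' A) = χ '' ext`.
Intended proof.  (⊇) `x ∈ ext`: `χ x ∈ I⁻(χ A)` by pushing the cofinality curve (inside
`ext ⊆ U`) through `χ` (isometric, t.o.p.: `IsFutureCausalCurveOn.comp_mdifferentiable`,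
`image_causalFuture_subset`, ConvergenceTransport.lean); `χ x ∈ J⁺(ι X)`: the maximal integral
curve of `−∇t*|_U` through `x` is an endless timelike curve of the window, meets the Cauchy leaf
exactly once, and not to the future of `x` because `u = t* − T(r)` increases along future timelike
curves (time function) and `u(x) ≥ 0`; push the segment through `χ`, its past end `χ(graph y) = ι(φ y)`.
(⊆) LAST-EXIT ARGUMENT (§C1): `p ∈ J⁺(ιX)`, `p ≪ χ a`; if the timelike curve from `p` is not
entirely inside the open set `χ(U)`, the segment after its last entry is the `χ`-image of a
past-inextendible timelike curve of the window (a limit point `w ∈ U` would give `χ w =` the entry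
point, by Hausdorffness of `𝒟`), hence crosses the Cauchy leaf at some `χ(graph y') = ι(φ y')`
strictly later — so `ιX ∋ q ≤ p ≤ e ≪ ι(φ y') ∈ ιX`, contradicting ACHRONALITY of the Cauchy
hypersurface `ιX` (`IsCauchyHypersurface` ⇒ achronal; push-up `J⁺ ∘ I⁺ ⊆ I⁺`,
`chronologicalFuture_causalFuture_holds`, CausalityPushUp.lean; points of `ιX` off `χ(Σᵉ)` are not
in `χ(U)` at all, since `χ(U)` is globally hyperbolic with Cauchy surface `χ(Σᵉ) ⊆ ιX`).  Hence the
curve lies in `χ(U)`, `p = χ x` with `u(x) ≥ 0`, and `r(x) > r₊` by the ONE-WAY MEMBRANE (future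
causal curves of the chart starting in `{r ≤ r₊}` stay there: Disproof §J1
`infall_of_causal_inside` / `not_outward_of_causal_horizon`, `Kerr.horizonCovector_causal`) since
`r(a) > r₊` — the only place `r₁ < r₊` matters for this stub.
Why it might fail: a typing subtlety of `causalFuture` (REFLEXIVE — used: leaf points of `ext` are
in `J⁺(ιX)` by `S ⊆ J⁺(S)`, Disproof §I) or of achronality for the corrected Cauchy notion (the
tree proves `IsCauchySurface.isAchronal_holds` for the OLD notion; the corrected
`IsCauchyHypersurface.isAchronal` is a named fact — prove it: two timelike-related points of `S`
give an endless timelike curve meeting `S` twice after extending both ends, `GeodesicExtension` /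
`TimelikeCurveLift`).  Cofinality with `A = ∅` is unsatisfiable (`ext ≠ ∅`), so no vacuity trap.
Leans on: `exteriorOf` (Statement.lean), `IsShieldWindow`, `CofinalIn`, `extSet`,
`LorentzianMetric.{causalFuture, chronologicalPast, IsCauchyHypersurface}`,
`chronologicalFuture_causalFuture_holds`, `IsCauchyHypersurface.exists_mem_of_isEndlessCausalCurve_holds`
(CauchyHypersurfaceCausalProofs), `image_causalFuture_subset`/`image_causalPast_subset`,
`Spacetime` is `T2Space`, Kerr membrane lemmas above. -/
def Sig.stub_exteriorIgnorance : Prop :=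
  ∀ [Kerr.Facts] (X : Type) [TopologicalSpace X] [ChartedSpace E3 X]
    [IsManifold (𝓡 3) ∞ X] [T2Space X] [SecondCountableTopology X] [ConnectedSpace X]
    (D : InitialDataSet (𝓡 3) X) (M a r₁ : ℝ) (hM : 0 ≤ M) (φ : Kerr.slice a r₁ → X)
    (ν : NormalField 𝓘(ℝ, E4) (graph M a r₁)),
    IsShield X D M a r₁ hM φ ν →
    ∀ (𝒟 : VacuumCauchyDevelopment D) (U : Opens (Kerr.region a r₁))
      (hU : IsConnected (U : Set (Kerr.region a r₁)))
      (χ : (windowSpacetime M a r₁ hM U hU).carrier → 𝒟.carrier),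
      IsShieldWindow 𝒟 M a r₁ hM φ ν U hU χ →
      ∀ A : Set (windowSpacetime M a r₁ hM U hU).carrier,
        A ⊆ extSet M a r₁ U → CofinalIn M a r₁ hM U hU A (extSet M a r₁ U) →
        Summit.FinalStateConjecture.exteriorOf 𝒟.toCauchyDevelopment (χ '' A) =
          χ '' extSet M a r₁ U

/-- **Stub 4 — `stub_kerrScriFar`: the vendored Kerr sanity fact at inner radius `8M`** (size L;
the TRANSFER TARGET `C⁺_A` of the card; = the `_holds` of the named fact
`kerr_hasCompleteFutureNullInfinity M a (8M)` of ModelData.lean l.745 for sub-extremal `(M, a)`: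
the chart `({r > 8M}, g_{M,a}, −g♯dt*)` seen from the closed far region
`Kerr.farSlice a (8M) = {‖y‖ ≥ √(64M² + a²) + 2}` of the FLAT leaf `{t* = 0}` with its Kerr–Schild
unit normal is sojourn-complete).  Prove it once in Literature (`provefact`; then this stub is one
line) by the M2 ENGINE of the companion cards `two-speed-optics-sojourn ≈ speed-limit-energy-floor`
(passed ×3; numerics N1/T1/checkB: 0 violations): outer cone `|v⃗| ≤ v⁰` for `g`-causal `v`
(Disproof §J1 `spatial_sq_le_of_causal`), conserved Killing energy `E = −g(γ̇, ∂_{t*})`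
(`OpensChart.hasDerivAt_momentum_of_isGeodesicOn` + `Kerr.fderiv_bilin_basisVector_zero`) with the
pinch `(1 − 4H)ṫ* ≤ E ≤ ṫ*`, so `ṫ* ≤ 2E` on `{r ≥ 8M}` (`H ≤ M/r ≤ ⅛`); inner cone
`(r + 2M)|v⃗| < (r − 2M)v⁰ ⇒` timelike, giving explicit radial causal fronts and
`F = {‖y‖ ≥ R₀', t* ≥ σ(‖y‖)} ⊆ J⁺(ι B₀)`, `B₀` = a coordinate shell of the far slice (compact);
ESCAPE DICHOTOMY: a maximal chart geodesic whose radius stays `≥ 8M` has bounded 1-jet on bounded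
parameter ranges hence unbounded domain (`exists_uniform_isGeodesicOn_of_isCompact`,
GeodesicUniformTime.lean, + maximality), one that reaches `r = 8M` (the chart edge here) has
first entered `F` at radius `≥ (ρ_p + R₀')/2 − 3.5M log(ρ_p/M)` and then needs affine time
`≥ (ρ_e − 9M)/(2E)` (banking; Disproof §J5 (vii): "bookkeeping may stop at `8M`"); on the flat
leaf the normalisation is against the KS normal (`E ∈ [1 − 4H, 1]`-type pinch, no bent-slice
factor).  Why it might fail: it is true on paper for all `M ≥ 0, a, r₀` (docstring of the fact;
TRIAGE r2-1/2/3 checked that `farSlice` excludes the coreless inner-edge artefact of Disproof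
§H1); the risk is formalisation size (Kerr null-geodesic API: `OpensChartGeodesicODE`,
`GeodesicMaximal`, `GeodesicExtension` exist; no Carter constant is needed).
Leans on: `kerr_hasCompleteFutureNullInfinity`, `Kerr.farSlice(Embed/Normal)`,
`HasCompleteFutureNullInfinity`, `IsNormalisedNullRayFrom`, `sojournTime`, the lemmas above. -/
def Sig.stub_kerrScriFar : Prop :=
  ∀ [Kerr.Facts] (M a : ℝ), 0 < M → |a| < M → kerr_hasCompleteFutureNullInfinity M a (8 * M)

/-- **Stub 5 — `stub_flowTransport`: KILLING-FLOW TRANSPORT of the flat-leaf fact to the bent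
leaf — THE LEVER of the card** (size M/L; the card's `First lemma` `cardA_first_lemma`, which
elaborates in `IdeateR2K4Sketch.lean`, restated with the landed `graph`; attacked on paper by the
disprover, Disproof §J3, and numerically by the three triagers: renormalisation factor
`c = −g(v, ν_KS) ∈ [0.882, 1.134]` at `r_p = 16M`, `[0.939, 1.065]` at `32M`, uniformly in
`a ≤ 0.999M` — N6 / T3 / checkB).  For sub-extremal `(M, a)`, `r₋ < r₁ < r₊`, the bent leaf
`graph M a r₁` with future unit normal `ν`: the fact at `r₀ = 8M` implies `BentLeafScriComplete`.
Intended proof.  Fix the fact's `B₀⁸ ⊆ farSlice a (8M)`; put `B₀ := {y ∈ slice a r₁ | r₁ + 1 ≤ r(0,y),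
‖y‖ ≤ R₀}` (compact in the open slice; `⊇` the inclusion of `B₀⁸`).  Given `s`, take the fact's
`B₁⁸` for `s' := 2s` and `R₁ ≥ sup‖B₁⁸‖, 16M + |a|, …`.  For a normalised ray `γ` of
`Kerr.region a r₁` from `graph p = (T(r_p), p)`, `‖p‖ > R₁`: the FLOW `Φ_σ(t*, y) = (t* + σ, y)`
(`Kerr.timeTranslate`, Barriers/HairyKerrBifurcation, or three lines inline) maps `Kerr.region a r₀`
to itself ISOMETRICALLY and t.o.p. (`Kerr.bilin` is `t*`-independent:
`Kerr.bilin_add_smul_basisVector_zero` / `fderiv_bilin_basisVector_zero`; Killing field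
`Kerr.isKillingField_stationaryField_holds`; flow lemmas `IsKillingField.image_flow_chronologicalFuture`,
`isFutureCausalCurveOn_flow_comp`, KillingFlowIsometry.lean).  Let `γ₈` be the maximal geodesic of
the chart `region a (8M)` through `γ(0)` with velocity `γ̇(0)` (= `γ` on the first component of
`γ⁻¹{r > 8M}`, `exists_isMaximalGeodesicOn`, `IsGeodesicOn.eqOn_of_velocity_eq_holds`), and
`γ̃ := Φ_{−T(r_p)} ∘ γ₈ ∘ (·/c)`, `c := −g(γ̇(0), ν_KS) > 0` (bounded above and below as quoted —
the Doppler factor of the KS/BL-normal boost `β = 2M/r`; formula `c = (N + T′dr(v))/√(1 + 2H)`,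
`N = √(−conormalSq) ∈ [0.99, 1.08]`, `T′ ≤ 0.15`, `|dr(v)| ≤ 1.003v⁰` at `r ≥ 16M`): a ray of
`region a (8M)` from the flat far-slice point `(0, p)`, KS-normalised (geodesic ODE form
`OpensChart.hasDerivAt_of_isGeodesicOn` is translation-invariant; affine rescaling).  Apply the
fact: `γ̃` complete ⇒ `dom` unbounded above; else
`sojourn(γ, dom, J⁺_{r₁}(graph '' B₀)) ≥ sojourn(γ₈, dom₈, Φ_{T_p} J⁺₈(ι₈ B₀⁸)) = sojourn(γ̃, dom̃, J⁺₈(ι₈ B₀⁸))/c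
≥ s'/c ≥ s` (`sojournTime_mono_left`, `sojournTime_mono`, `Real.volume` scaling under `t ↦ t/c`,
`c ≤ 1.134 < 2`), using `Φ_{T_p} J⁺₈(S) = J⁺₈(Φ_{T_p} S) ⊆ J⁺_{r₁}(Φ_{T_p} S)` (`Kerr.region_mono`)
and `Φ_{T_p}(0, y) = (T_p, y) ∈ J⁺_{r₁}(graph y)` for `y ∈ B₀⁸` along `∂_{t*}` — future TIMELIKE at
`r(y) > 8M > 2M` (`Kerr.two_mul_scalarH_lt_one_of_lt`, Disproof §J1 `stationary_timelike_iff`) —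
because `T_p = T(r_p) ≥ T(r(y))` (`T` monotone: landed `bentSlope_nonneg`, `deriv_bentHeight`; and
`R₁` large), then transitivity of `≤` (`causalFuture_trans`, CausalFutureProofs).  Sharpening
(TRIAGE r2-1): state the transport ONCE for two flow-related spacelike leaves of a stationary chart
with a two-sided bound on the relative normalisation — it is then reusable Literature.
Why it might fail: only if `c` degenerated (`→ 0` or `∞`) along admissible null directions
uniformly in `|a| < M` — excluded analytically and numerically (above); or if `∂_{t*}` failed to be
causal where the fact's `B₀⁸` lives — impossible at `r > 8M`.  No ergoregion observer is ever used
(evades `KerrNoTimelikeKillingCombination` and the `a/M > 0.91` helix failure, TRIAGE r1-3 L3).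
Leans on: `kerr_hasCompleteFutureNullInfinity` (hypothesis), `graph`, `BentLeafScriComplete`,
`Kerr.timeTranslate`/`coe_timeTranslate`, `Kerr.isKillingField_stationaryField_holds`,
`IsKillingField.image_flow_chronologicalFuture`, `exists_isMaximalGeodesicOn`,
`IsGeodesicOn.eqOn_of_velocity_eq_holds`, `OpensChart.hasDerivAt_of_isGeodesicOn`,
`sojournTime_mono(_left)`, `Kerr.region_mono`, `Kerr.two_mul_scalarH_lt_one_of_lt`,
`bentSlope_nonneg`, `conormalSq_bl_neg`. -/
def Sig.stub_flowTransport : Prop :=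
  ∀ [Kerr.Facts] (M a r₁ : ℝ) (hM : 0 ≤ M),
    |a| < M → Kerr.rMinus M a < r₁ → r₁ < Kerr.rPlus M a →
    ∀ ν : NormalField 𝓘(ℝ, E4) (graph M a r₁),
      (Kerr.smoothMetric M a r₁).IsSpacelikeImmersion 𝓘(ℝ, E3) (graph M a r₁) →
      (Kerr.smoothMetric M a r₁).IsFutureUnitNormal 𝓘(ℝ, E3)
        ((Kerr.timeOrientation M a r₁ hM).ofLE le_top) (graph M a r₁) ν →
      kerr_hasCompleteFutureNullInfinity M a (8 * M) →
      BentLeafScriComplete M a r₁ hM ν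

/-- **Stub 6 — `stub_scriPush`: clause (a) of the crux from the chart-level completeness — ray
transport through `χ` and inner-edge capping** (size M/L; the card's "RayTransport +
InnerEdgeCapping", TRIAGE r2-1 S2 / r1-2 T6, Disproof §C1 (last sentence), §H1, §H3).  For an
ADMISSIBLE shielded datum, a shield window `(U, χ)` and `BentLeafScriComplete`:
`HasCompleteNullInfinity 𝒟`.
Intended proof.  `B₀^𝒟 := φ '' B₀` (compact).  Given `s`, with `R₁` from the chart:
`B₁^𝒟 := X ∖ φ({y | R₁ < ‖y‖})` — closed (`φ` open), and COMPACT: this is INNER-EDGE CAPPING, the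
one place admissibility is used (Disproof §H1: for the coreless slice the statement is FALSE):
by `IsSoleEnd` the complement of `e.far R'` is compact, and the shield's far part `φ{‖y‖ > R₁}`
contains `e.far R''` for `R''` large (the shield end IS the sole end: `φ` is a Riemannian isometry
`(slice, graph^*g) → (X, h)` onto the open `range φ` by the shield identity `φ^*h = graph^*g`;
far-inclusion / closedness of `φ{r ≥ R}` by lifting short `h`-paths, connectedness and infinite
volume of `e.far`, Disproof §H3 (a)–(c) = card speed-limit step (6) = card convex-light step (4);
alternatively completeness of `(X, h)` caps Cauchy sequences `φ(yₙ)`, `r(yₙ) → r₁`).  RAY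
TRANSPORT: for `p ∉ B₁^𝒟`, `p = φ y`, `‖y‖ > R₁`, and a normalised ray `γ` of `𝒟` from
`ι(φ y) = χ(graph y)` (`embed_comm`), normalised against `ν_𝒟(φ y) = dχ(ν y)` (`normal_comm`): the
maximal chart geodesic `γ_K` from `graph y` with velocity `dχ⁻¹(γ̇ 0)` (`χ` is a local
diffeomorphism) is a normalised ray for `(graph, ν)`; it stays in `W⁺ ⊆ U` for `t ≥ 0` (`u` is a
time function, §B′/landed `conormalForm_*`), so `χ ∘ γ_K` is a geodesic of `𝒟` with the same
initial data (isometric immersions map geodesics to geodesics: `leviCivita_comap_mpullback`,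
ConnectionNaturality) and `γ ⊇ χ ∘ γ_K` on `dom_K ∩ [0, ∞)` (maximality of `γ`, one-sided
uniqueness `GeodesicOneSidedUniqueness`).  If `γ_K` is complete, `¬ BddAbove dom`.  Else
`sojourn_𝒟(γ, dom, J⁺(ι B₀^𝒟)) ≥ sojourn(χ∘γ_K, dom_K, χ(J⁺_K(graph '' B₀))) = sojourn_K(γ_K, …) ≥ s`
(`χ` injective on `U`; `J⁺_K(graph B₀)`-curves stay in `W⁺ ⊆ U`, so
`χ(J⁺_K(graph B₀)) ⊆ J⁺_𝒟(χ graph B₀) = J⁺_𝒟(ι φ B₀)`, `image_causalFuture_subset`;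
`sojournTime_mono(_left)`).
Why it might fail: only via the compactness of `B₁^𝒟` (load-bearing by §H1 — hence the admissible
hypothesis) or a mismatch of normalisations (excluded by `normal_comm`).
Leans on: `HasCompleteNullInfinity` (Statement.lean), `IsShieldWindow`, `BentLeafScriComplete`,
`admissibleVacuumData` (`IsComplete`, `AFEnd.IsSoleEnd`, `isCompact_compl_far` (EndRadius)),
`image_causalFuture_subset`, `IsFutureCausalCurveOn.comp_mdifferentiable`,
`leviCivita_comap_mpullback`, `IsMaximalGeodesicOn`, `sojournTime_mono`, `sojournTime_mono_left`,
`PseudoRiemannianMetric.hasLeviCivita`. -/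
def Sig.stub_scriPush : Prop :=
  ∀ [Kerr.Facts] (X : Type) [TopologicalSpace X] [ChartedSpace E3 X]
    [IsManifold (𝓡 3) ∞ X] [T2Space X] [SecondCountableTopology X] [ConnectedSpace X]
    (D : InitialDataSet (𝓡 3) X) (M a r₁ : ℝ) (hM : 0 ≤ M) (φ : Kerr.slice a r₁ → X)
    (ν : NormalField 𝓘(ℝ, E4) (graph M a r₁)),
    D ∈ admissibleVacuumData X → IsShield X D M a r₁ hM φ ν →
    ∀ (𝒟 : VacuumCauchyDevelopment D) (U : Opens (Kerr.region a r₁))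
      (hU : IsConnected (U : Set (Kerr.region a r₁)))
      (χ : (windowSpacetime M a r₁ hM U hU).carrier → 𝒟.carrier),
      IsShieldWindow 𝒟 M a r₁ hM φ ν U hU χ →
      BentLeafScriComplete M a r₁ hM ν →
      Summit.FinalStateConjecture.HasCompleteNullInfinity 𝒟.toCauchyDevelopment

/-- **Stub 7 — `stub_exhaustiveCharts`: the one-black-hole decomposition of `O = χ '' ext` with
exhaustive charts — HARDEST** (size XL; Disproof §C3/§C4/§F/§I verbatim, or the single-gauge
variant `one-gauge-sliding-seam` (passed ×3); flat `C²` clause also by `zero-mass-scaling-deviation`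
(passed ×3)).  For a shield window there are `dec : FinalStateDecomposition 𝒟.toSpacetime (χ '' ext) 2`
with `N = 1`, `(mass, spin) = (M, a)`, `HasExhaustiveCharts dec`, and a set `A ⊆ ext`, cofinal in
`ext`, with `dec.charted = χ '' A`.
Intended construction (all in the chart, then `χ ∘ ·`).  Motion `(1, 0)` (`poincareInv 1 0 = id`,
`boostedKerrBilin_one_zero`).  HOLE CHART `Ψ₁(x⁰, x) = χ(θ(x⁰) + B(θ(x⁰), r), x)` with the
x⁰-RECEDING bend `B(x⁰, r) = c₀ + T(r)·χ_s((r − 2R(x⁰))/R(x⁰))`, `R(τ) = √τ + 1`,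
`θ(x⁰) = τ₀ + g_s(x⁰ − τ₀)` the smooth squeeze of §I (so `Ψ₁` is smooth on the WHOLE background
domain `Kerr.exterior M a` and valued in `W⁺`; `IsLateChart.isOpenEmbedding/image_subset` are asked
on `{x⁰ > τ₀}` only).  On the open set `{r < 2R(x⁰)}` — which contains every truncated slab
eventually and is open in all four variables, §J5 (iii) — `B ≡ c₀`, i.e. `Ψ₁ = χ ∘ Φ_{c₀}` there: an
ISOMETRY (the flow once more; card part (b)), so `truncDeviationCk … R τ = 0` eventually for every
`R` (`tendsto_truncDeviationCk`) and `= 0` along `R₁(τ) := R(τ)` (`HasExhaustiveCharts` (i));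
`∂B/∂x⁰ = O(M log τ/τ) → 0` makes `Ψ₁` an open embedding for `τ₀(M)` large and
`T(3R(x⁰)) ≤ x⁰ + c₀` keeps images above the leaf (landed `bentHeight_le_two_mul_log`).  A
STATIONARY hole bend is DEAD (landed negative lemma `not_tendsto_stationaryBend_dev`,
`Theorems/KerrShieldedSettles/Negative/StationaryBendDead.lean`; Disproof §G; TRIAGE r1-2 T2) and
UNBENT charts are refuted (`not_exists_unbent_bound`, Disproof §B) — do not use either.  FLAT
CHART `Ψ₀(x⁰, y) = χ(x⁰ + c₀ + T(r), y)` on `flatDomain = {x⁰ > τ₀ − 1, r > √x⁰}` (excision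
`ρ(t) = √t`, `ρ/t → 0`, `setOf_lt_excision_subset_flatDomain` with `{x⁰ > τ₀, r > √x⁰}`, §J5 (iv));
`deviationCk = C²`-sup over `{x⁰ = τ, r > √τ}` of the ZERO-EXTENDED `Ψ₀^*g − η =
−2T′dx⁰dr − T′²dr² + 2H(dx⁰ + (T′∂ᵢr + ℓᵢ)dxⁱ)²` (χ isometry: `Spacetime.deviation_comp`,
ConvergenceTransport) `= O(M/√τ) → 0` (tree: `Kerr.abs_inverseMetric_sub_etaComp_le`,
`Kerr.abs_fderiv_*` / KerrSchildDerivativeDecay for `k ≤ 2`, `T′ = 2Mr/Δ` beyond `8M`; or the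
exact scale covariance of `(r, H, ℓ, g, T′)`, card zero-mass-scaling, TRIAGE N5/T6/checkD;
`iteratedFDeriv` of the zero extension is local at interior points of the open `flatDomain`,
`Filter.EventuallyEq.iteratedFDeriv_eq`).  `exists_pairwise_disjoint` is vacuous for `N = 1`.
COVERING (`diff_subset_causalPast` at `τ₀` and `HasExhaustiveCharts` (ii) for every `τ₁ > τ₀`,
§C4/§F): in chart coordinates `certifiedLate`/`certifiedSlab` are the explicit sets of §F; a point
of `ext` outside `certifiedLate` climbs at fixed `x⃗` along `∂_{t*}` (timelike off the ergoregion)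
or at fixed `(r, θ)` along `∂_t + ω(r,θ)∂_φ` / the DRSR helix (`Kerr.isTimelike_drsrField`,
`Kerr.exists_isTimelike_stationaryField_add_smul_axialField`, KerrTimelikeSpan — all `|a| < M`,
evades the `{∂_t, K_H}` failure at `a/M > 0.91`) to the slab, staying in `ext`; slab points
themselves by REFLEXIVITY of `J⁻` (§I); push the curves through `χ` (`image_causalPast_subset`).
COFINALITY of `A :=` (late chart preimages) in `ext` by the same climbs (the hole near zone
`{r < 2R}` swallows every fixed radius eventually), and `dec.charted = χ '' A` by unfolding
`charted = radiationZone ∪ region 0`.  Images lie in `χ '' ext` since `Ψ₁, Ψ₀` take values in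
`{r > r₊, t* ≥ T(r)}`.
Why it might fail: the thin margins are quantitative and were re-derived by three triagers
(`τ₀(M) = O(max(60, M log M))`, `c₀ = O(M)`; one-gauge: `∂ₛh > 0` only for `s ≥ 2`, take `τ₀ = 3`);
the real risk is formalisation volume (`IsLateChart.contMDiff` on the whole domain, `iteratedFDeriv`
bookkeeping of the zero extension, the `∀ τ₁` case analysis of §F) — hence HARDEST, the lead's own.
Leans on: `FinalStateDecomposition` (all 19 fields), `HasExhaustiveCharts`, `certifiedLate/Slab`,
`IsLateChart`, `Spacetime.deviationCk/truncDeviationCk/deviation_comp`, `boostedKerrBackground`,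
`Minkowski.backgroundOn`, `Kerr.exterior`, `Kerr.timeTranslate`, `bentHeight`/`bentSlope` lemmas,
`bentHeight_le_two_mul_log`, `Kerr.isTimelike_drsrField`,
`Kerr.exists_isTimelike_stationaryField_add_smul_axialField`, `image_causalPast_subset`,
`IsShieldWindow`, `CofinalIn`, `extSet`, `FinalStateDecomposition.charted`. -/
def Sig.stub_exhaustiveCharts : Prop :=
  ∀ [Kerr.Facts] (X : Type) [TopologicalSpace X] [ChartedSpace E3 X]
    [IsManifold (𝓡 3) ∞ X] [T2Space X] [SecondCountableTopology X] [ConnectedSpace X]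
    (D : InitialDataSet (𝓡 3) X) (M a r₁ : ℝ) (hM : 0 ≤ M) (φ : Kerr.slice a r₁ → X)
    (ν : NormalField 𝓘(ℝ, E4) (graph M a r₁)),
    IsShield X D M a r₁ hM φ ν →
    ∀ (𝒟 : VacuumCauchyDevelopment D) (U : Opens (Kerr.region a r₁))
      (hU : IsConnected (U : Set (Kerr.region a r₁)))
      (χ : (windowSpacetime M a r₁ hM U hU).carrier → 𝒟.carrier),
      IsShieldWindow 𝒟 M a r₁ hM φ ν U hU χ →
      ∃ (dec : FinalStateDecomposition 𝒟.toSpacetime (χ '' extSet M a r₁ U) 2)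
        (A : Set (windowSpacetime M a r₁ hM U hU).carrier),
        dec.N = 1 ∧ (∀ i, dec.mass i = M ∧ dec.spin i = a) ∧
        Summit.FinalStateConjecture.HasExhaustiveCharts dec ∧
        A ⊆ extSet M a r₁ U ∧ dec.charted = χ '' A ∧
        CofinalIn M a r₁ hM U hU A (extSet M a r₁ U)

/-! ## Registered stubs (the ONLY sorries of this file) -/

/-- Stub 1 (XL, named-fact debt `Kerr.isRicciFlat`; see `Sig.stub_kerrVacuum`). -/
theorem stub_kerrVacuum : Sig.stub_kerrVacuum := by
  sorry

/-- Stub 2 (L, the explicit Kerr window + `SubdataDevelopmentsEmbed`; see `Sig.stub_shieldWindow`). -/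
theorem stub_shieldWindow : Sig.stub_shieldWindow := by
  sorry

/-- Stub 3 (L, exterior ignorance / last-exit; see `Sig.stub_exteriorIgnorance`). -/
theorem stub_exteriorIgnorance : Sig.stub_exteriorIgnorance := by
  sorry

/-- Stub 4 (L, named-fact debt `kerr_hasCompleteFutureNullInfinity M a (8M)`, the M2 engine;
see `Sig.stub_kerrScriFar`). -/
theorem stub_kerrScriFar : Sig.stub_kerrScriFar := by
  sorry

/-- Stub 5 (M/L, THE LEVER: Killing-flow transport; see `Sig.stub_flowTransport`). -/
theorem stub_flowTransport : Sig.stub_flowTransport := by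
  sorry

/-- Stub 6 (M/L, ray transport through `χ` + inner-edge capping; see `Sig.stub_scriPush`). -/
theorem stub_scriPush : Sig.stub_scriPush := by
  sorry

/-- Stub 7 (XL, HARDEST: the `N = 1` decomposition with exhaustive charts; see
`Sig.stub_exhaustiveCharts`). -/
theorem stub_exhaustiveCharts : Sig.stub_exhaustiveCharts := by
  sorry

/-! ## The composition: the seven stubs (and the route item `SubdataDevelopmentsEmbed`, the
crux's declared dependency) conclude the crux BY NAME — real proof, no `sorry` -/

/-- **`KerrShieldedSettles` from the seven stubs and `SubdataDevelopmentsEmbed`.**  Unpack the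
crux: `D` admissible, the shield `⟨M, a, r₁, hM, T, φ, ψ, ν, …⟩`, a maximal `𝒟`.  Substitute
`T = bentHeight M a` (`bentHeight_eq_literal` is `rfl`) and `ψ = graph M a r₁` (`psi_eq_graph`).
Stub 2 (fed with the route item, the shield, stub 1 at `r₀ = r₁ > r₋ ≥ 0`, and maximality) gives the
window `(U, χ)`.  Clause (a): stub 6 ∘ stub 5 ∘ stub 4 (`0 < M` from `|a| < M`).  Clauses (b)/(c):
stub 7 gives `dec`, `A`; take `O := χ '' ext`; sub-extremality from `(mass, spin) = (M, a)`,
`|a| < M`; `O = exteriorOf 𝒟 dec.charted` is stub 3 at `A` after `dec.charted = χ '' A`. -/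
theorem KerrShieldedSettles_of :
    Sig.stub_kerrVacuum → Sig.stub_shieldWindow → Sig.stub_exteriorIgnorance →
    Sig.stub_kerrScriFar → Sig.stub_flowTransport → Sig.stub_scriPush →
    Sig.stub_exhaustiveCharts →
    Summit.FinalStateConjecture.FinalStateConjecture.Theses.SwallowTheDatum.SubdataDevelopmentsEmbed →
      Summit.FinalStateConjecture.FinalStateConjecture.Theses.SwallowTheDatum.KerrShieldedSettles := by
  intro h1 h2 h3 h4 h5 h6 h7 hsub instF X _ _ _ _ _ _ D hD hshield 𝒟 hmax
  obtain ⟨M, a, r₁, hM, T, φ, ψ, ν, ha, hr₁, hr₂, hT, hKc, hφo, hφs, hψ, hsp, hν, hh, hk⟩ := hshield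
  -- `T` is the hard-coded height, `ψ` is its graph
  have hT' : T = bentHeight M a := hT.trans (bentHeight_eq_literal M a).symm
  obtain rfl : ψ = graph M a r₁ := psi_eq_graph hT' hψ
  have hS : IsShield X D M a r₁ hM φ ν := ⟨ha, hr₁, hr₂, hKc, hφo, hφs, hsp, hν, hh, hk⟩
  have hr₀ : 0 < r₁ := lt_of_le_of_lt (Kerr.IsSubextremal.rMinus_nonneg ha) hr₁
  -- the window (stub 2, fed with the route item, the shield, stub 1 and maximality)
  obtain ⟨U, hU, χ, hW⟩ := h2 X D M a r₁ hM φ ν hsub hS (h1 M a r₁ hr₀) 𝒟 hmax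
  refine ⟨?_, ?_⟩
  · -- clause (a): the vendored `t* = 0` fact (stub 4), transported to the bent leaf by the
    -- stationary flow (stub 5) and pushed into `𝒟` through `χ` (stub 6)
    exact h6 X D M a r₁ hM φ ν hD hS 𝒟 U hU χ hW
      (h5 M a r₁ hM ha hr₁ hr₂ ν hsp hν (h4 M a (mass_pos ha) ha))
  · -- clauses (b)/(c): the `N = 1` decomposition of `O = χ '' {r > r₊, t* ≥ T(r)}` (stub 7)
    -- and the identification `O = exteriorOf 𝒟 dec.charted` (stub 3)
    obtain ⟨dec, A, -, hpar, hexh, hA, hch, hcof⟩ := h7 X D M a r₁ hM φ ν hS 𝒟 U hU χ hW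
    refine ⟨χ '' extSet M a r₁ U, dec, fun i ↦ ?_, ?_, hexh⟩
    · rw [Kerr.IsSubextremal, (hpar i).1, (hpar i).2]
      exact ha
    · rw [hch]
      exact (h3 X D M a r₁ hM φ ν hS 𝒟 U hU χ hW A hA hcof).symm

/-- The skeleton instantiated: the crux from the seven registered stubs, given the route item
`SubdataDevelopmentsEmbed` (stmt-FinalStateConjecture-10053, the crux's declared dependency; being
proved in `Theorems/SwallowTheDatumSubdataDevelopmentsEmbed*.lean`).  When the last stub lands this
is the crux proof (closed modulo 10053 until that item lands). -/
theorem KerrShieldedSettles_skeleton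
    (hsub : Summit.FinalStateConjecture.FinalStateConjecture.Theses.SwallowTheDatum.SubdataDevelopmentsEmbed) :
    Summit.FinalStateConjecture.FinalStateConjecture.Theses.SwallowTheDatum.KerrShieldedSettles :=
  KerrShieldedSettles_of stub_kerrVacuum stub_shieldWindow stub_exteriorIgnorance stub_kerrScriFar
    stub_flowTransport stub_scriPush stub_exhaustiveCharts hsub

end Summit.FinalStateConjecture.FinalStateConjecture.Cruxes.KerrShieldedSettles.KillingFlowTransport

end
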